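import Summits.MatrixMultiplication.OmegaCensus.SmallFormats.RankOnePlaneCapColBlocks
import HarnessLib

/-!
# ω-census family (a): the elementary gauge — column transforms, term rescaling, and the head
canonical forms over `𝔽₃`

Cell `pub-omega` (unit `pub-omega-tensor`, gen 29), topic `Summits/MatrixMultiplication/OmegaCensus`
(sub-folder `SmallFormats`). Framing (verbatim): lottery ticket; floor = certified bounds/negative
ranges. HONEST FRAMING: the 'elementary gauge lemma (GL₅ × signs)' on which the gauge-SAT instrument
of the `𝔽₃` `⟨2,2,5⟩@17` X-marginal census rests (tensor-g28 kitjob-gs README §gauge, steps (2)–(4)),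
as tree theorems: the group acts on computations WITHOUT changing the X-forms, and the finite lists of
head canonical forms used by the encoder are complete. Not a bound on any rank, not progress on `ω`.

* `exists_colTransform` (any field, any `⟨c,m,n⟩`): for `A A' ∈ k^{n×n}` with `A A' = 1`, a
  computation `(f_i, g_i, W_i)` of `XY` yields the computation `(f_i, g_i(· A), W_i A')` — same
  X-forms (so the X-marginal is unchanged), Y-coefficient matrices `G_i ↦ G_i Aᵀ`, outputs
  `W_i ↦ W_i A'`; with `A` invertible this moves any prescribed output row space `F′` to coordinates.
* `exists_rescale`: `(f_i, g_i, W_i) ↦ (c_i f_i, d_i g_i, W_i)` for `c_i d_i = 1` (per-term signs).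
* `head_canonical_GL2_gf3` / `head_canonical_borel_gf3` (`decide`): every `H ∈ 𝔽₃^{2×2}` is moved
  by some invertible `N` (right action `H ↦ H N` on its two rows), resp. by some invertible LOWER
  TRIANGULAR `N` (the stabiliser of the line `⟨e₀⟩`, 'line' position), into the encoder's list of
  6, resp. 13, head forms (`canonical_heads(2,'GL')`, `canonical_heads(2,'borel2')` of gaugesat.py) —
  so the 6 + 13 + 6 = 25 cases of the v1.2 gauge exhaust the heads.
-/

namespace Summit.MatrixMultiplication.OmegaCensus.RankOnePlaneCapGeneral

open Module Matrix Literature.Computability.AlgebraicComplexity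

variable {k : Type*} [Field k] {c m n : ℕ} {ι : Type*} [Fintype ι]

/-! ### The group acts without changing the X-forms -/

/-- **Column transform.** If `A A' = 1` in `k^{n×n}`, a computation `(f_i, g_i, W_i)_i` of
`⟨c,m,n⟩` yields the computation `(f_i, Y ↦ g_i(Y A), W_i A')_i` of the same map with the SAME
X-forms: `X Y = X (Y A) A' = ∑ f_i(X) g_i(YA) · W_i A'`. -/
theorem exists_colTransform (β : BilinComp (mulBilin k c m n) ι) (A A' : Matrix (Fin n) (Fin n) k)
    (hA : A * A' = 1) :
    ∃ β' : BilinComp (mulBilin k c m n) ι,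
      (∀ i, β'.f i = β.f i) ∧ (∀ i Y, β'.g i Y = β.g i (Y * A)) ∧ (∀ i, β'.w i = β.w i * A') := by
  refine ⟨{ f := β.f
            g := fun i => (β.g i) ∘ₗ ((mulBilin k m n n).flip A)
            w := fun i => β.w i * A'
            map_eq_sum := fun X Y => ?_ }, fun i => rfl, fun i Y => rfl, fun i => rfl⟩
  have h := β.map_eq_sum X (Y * A)
  rw [mulBilin_apply] at h
  simp only [LinearMap.coe_comp, Function.comp_apply, LinearMap.flip_apply, mulBilin_apply]
  calc X * Y = X * (Y * A) * A' := by rw [Matrix.mul_assoc, Matrix.mul_assoc, hA, Matrix.mul_one]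
    _ = (∑ i, (β.f i X * β.g i (Y * A)) • β.w i) * A' := by rw [h]
    _ = ∑ i, (β.f i X * β.g i (Y * A)) • (β.w i * A') := by
        rw [Matrix.sum_mul]
        exact Finset.sum_congr rfl fun i _ => Matrix.smul_mul _ _ _

/-- **Term rescaling** (per-term signs): for scalars with `c_i d_i = 1`, `(c_i f_i, d_i g_i, W_i)_i`
is again a computation of the same map (the projective classes of the X-forms are unchanged). -/
theorem exists_rescale {U V W : Type*} [AddCommGroup U] [Module k U] [AddCommGroup V] [Module k V]
    [AddCommGroup W] [Module k W] {φ : U →ₗ[k] V →ₗ[k] W} (β : BilinComp φ ι) (cf dg : ι → k)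
    (h : ∀ i, cf i * dg i = 1) :
    ∃ β' : BilinComp φ ι,
      (∀ i, β'.f i = cf i • β.f i) ∧ (∀ i, β'.g i = dg i • β.g i) ∧ (∀ i, β'.w i = β.w i) := by
  refine ⟨{ f := fun i => cf i • β.f i, g := fun i => dg i • β.g i, w := β.w,
            map_eq_sum := fun u v => ?_ }, fun i => rfl, fun i => rfl, fun i => rfl⟩
  rw [β.map_eq_sum u v]
  refine Finset.sum_congr rfl fun i _ => ?_
  simp only [LinearMap.smul_apply, smul_eq_mul]
  congr 1
  calc β.f i u * β.g i v = (cf i * dg i) * (β.f i u * β.g i v) := by rw [h i, one_mul]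
    _ = cf i * β.f i u * (dg i * β.g i v) := by ring

/-! ### Head canonical forms over `𝔽₃` (the case lists of the v1.2 gauge) -/

/-- **Heads under `GL₂(𝔽₃)`** ('same'/'zero'/single-plane positions). Every `H ∈ 𝔽₃^{2×2}` is
carried by the right action of some invertible `N` (`H ↦ H N`, i.e. both rows `h ↦ h N`) into one
of the six forms `0`, `(e₀;0)`, `(e₀;e₀)`, `(e₀;2e₀)`, `(0;e₀)`, `(e₀;e₁)` — the list
`canonical_heads(2,'GL')` of the encoder. (Invertibility as `N₀₀N₁₁ − N₀₁N₁₀ ≠ 0`, `= det N` by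
`Matrix.det_fin_two`.) -/
theorem head_canonical_GL2_gf3 :
    ∀ a b c d : ZMod 3, ∃ p q r s : ZMod 3, p * s - q * r ≠ 0 ∧
      (!![a, b; c, d] * !![p, q; r, s]) ∈
        ([!![0, 0; 0, 0], !![1, 0; 0, 0], !![1, 0; 1, 0], !![1, 0; 2, 0], !![0, 0; 1, 0],
          !![1, 0; 0, 1]] : List (Matrix (Fin 2) (Fin 2) (ZMod 3))) := by
  decide

/-- **Heads under the Borel subgroup** ('line' position: the residual group must fix the line
`⟨e₀⟩ = F′₁ ∩ F′₂`, i.e. `N` is lower triangular, `N₀₁ = 0`). Every `H ∈ 𝔽₃^{2×2}` is carried by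
some invertible lower-triangular `N` into one of the thirteen forms `0`, `(0;e₀)`, `(0;e₁)`,
`(e₀;0)`, `(e₀;e₀)`, `(e₀;2e₀)`, `(e₁;0)`, `(e₁;e₁)`, `(e₁;2e₁)`, `(e₀;e₁)`, `(e₁;e₀)`,
`(e₁;e₀+e₁)`, `(e₁;e₀+2e₁)` — the list `canonical_heads(2,'borel2')` of the encoder. -/
theorem head_canonical_borel_gf3 :
    ∀ a b c d : ZMod 3, ∃ p r s : ZMod 3, p * s ≠ 0 ∧
      (!![a, b; c, d] * !![p, 0; r, s]) ∈
        ([!![0, 0; 0, 0], !![0, 0; 1, 0], !![0, 0; 0, 1], !![1, 0; 0, 0], !![1, 0; 1, 0],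
          !![1, 0; 2, 0], !![0, 1; 0, 0], !![0, 1; 0, 1], !![0, 1; 0, 2], !![1, 0; 0, 1],
          !![0, 1; 1, 0], !![0, 1; 1, 1], !![0, 1; 1, 2]] : List (Matrix (Fin 2) (Fin 2) (ZMod 3))) := by
  decide

/-! ### The residual group of step (3) is compatible with the positions of steps (1)–(2) -/

/-- The block-diagonal extension `diag(N, I₃) ∈ k^{5×5}` of a `2 × 2` matrix `N`. -/
theorem blockDiag_fin5_apply (N : Matrix (Fin 2) (Fin 2) k) (x : Fin 5 → k) :
    let M : Matrix (Fin 5) (Fin 5) k := Matrix.of fun i j =>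
      if hi : i.val < 2 then (if hj : j.val < 2 then N ⟨i.val, hi⟩ ⟨j.val, hj⟩ else 0)
      else (if i = j then 1 else 0)
    (x ᵥ* M) 0 = x 0 * N 0 0 + x 1 * N 1 0 ∧ (x ᵥ* M) 1 = x 0 * N 0 1 + x 1 * N 1 1 ∧
      (x ᵥ* M) 2 = x 2 ∧ (x ᵥ* M) 3 = x 3 ∧ (x ᵥ* M) 4 = x 4 := by
  intro M
  simp only [M, Matrix.vecMul, dotProduct, Fin.sum_univ_five, Matrix.of_apply]
  refine ⟨?_, ?_, ?_, ?_, ?_⟩ <;> simp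

/-- **Residual group compatibility** (the desk remark behind step (3) of the gauge). The head of the
first `C₁`-output is normalised by `x ↦ x · diag(N, I₃)` with `N` invertible (`N N' = 1`): this map
is invertible (`diag(N,I₃) diag(N',I₃) = 1`), acts on a row supported on columns `0,1` as `h ↦ h N`
(so a head `H` becomes `H N`), preserves 'rows supported on columns `0,1`' (`F′₁ = ⟨e₀,e₁⟩`, the
'same' position) and 'rows supported on columns `2,3`' (the 'zero' position) for EVERY `N`, and
preserves 'rows supported on columns `0,2`' (the 'line' position) when `N` is lower triangular
(`N₀₁ = 0`) — which is why the 'line' cases use the Borel list `head_canonical_borel_gf3` and the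
others the `GL₂` list `head_canonical_GL2_gf3`. -/
theorem blockDiag_fin5_gauge (N N' : Matrix (Fin 2) (Fin 2) k) (hN : N * N' = 1) :
    let M : Matrix (Fin 5) (Fin 5) k := Matrix.of fun i j =>
      if hi : i.val < 2 then (if hj : j.val < 2 then N ⟨i.val, hi⟩ ⟨j.val, hj⟩ else 0)
      else (if i = j then 1 else 0)
    let M' : Matrix (Fin 5) (Fin 5) k := Matrix.of fun i j =>
      if hi : i.val < 2 then (if hj : j.val < 2 then N' ⟨i.val, hi⟩ ⟨j.val, hj⟩ else 0)
      else (if i = j then 1 else 0)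
    M * M' = 1 ∧
    (∀ x : Fin 5 → k, x 2 = 0 → x 3 = 0 → x 4 = 0 →
      (x ᵥ* M) 2 = 0 ∧ (x ᵥ* M) 3 = 0 ∧ (x ᵥ* M) 4 = 0 ∧
      (x ᵥ* M) 0 = (![x 0, x 1] ᵥ* N) 0 ∧ (x ᵥ* M) 1 = (![x 0, x 1] ᵥ* N) 1) ∧
    (∀ x : Fin 5 → k, x 0 = 0 → x 1 = 0 → x 4 = 0 →
      (x ᵥ* M) 0 = 0 ∧ (x ᵥ* M) 1 = 0 ∧ (x ᵥ* M) 4 = 0) ∧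
    (N 0 1 = 0 → ∀ x : Fin 5 → k, x 1 = 0 → x 3 = 0 → x 4 = 0 →
      (x ᵥ* M) 1 = 0 ∧ (x ᵥ* M) 3 = 0 ∧ (x ᵥ* M) 4 = 0) := by
  intro M M'
  have h00 : N 0 0 * N' 0 0 + N 0 1 * N' 1 0 = 1 := by
    have := congrFun (congrFun hN 0) 0; simpa [Matrix.mul_apply, Fin.sum_univ_two] using this
  have h01 : N 0 0 * N' 0 1 + N 0 1 * N' 1 1 = 0 := by
    have := congrFun (congrFun hN 0) 1; simpa [Matrix.mul_apply, Fin.sum_univ_two] using this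
  have h10 : N 1 0 * N' 0 0 + N 1 1 * N' 1 0 = 0 := by
    have := congrFun (congrFun hN 1) 0; simpa [Matrix.mul_apply, Fin.sum_univ_two] using this
  have h11 : N 1 0 * N' 0 1 + N 1 1 * N' 1 1 = 1 := by
    have := congrFun (congrFun hN 1) 1; simpa [Matrix.mul_apply, Fin.sum_univ_two] using this
  refine ⟨?_, ?_, ?_, ?_⟩
  · ext i j
    fin_cases i <;> fin_cases j <;>
      simp [M, M', Matrix.mul_apply, Fin.sum_univ_five, Matrix.of_apply, h00, h01, h10, h11]
  · intro x h2 h3 h4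
    obtain ⟨e0, e1, e2, e3, e4⟩ := blockDiag_fin5_apply N x
    refine ⟨by rw [e2, h2], by rw [e3, h3], by rw [e4, h4], ?_, ?_⟩
    · rw [e0]; simp [Matrix.vecMul, dotProduct, Fin.sum_univ_two]
    · rw [e1]; simp [Matrix.vecMul, dotProduct, Fin.sum_univ_two]
  · intro x h0 h1 h4
    obtain ⟨e0, e1, e2, e3, e4⟩ := blockDiag_fin5_apply N x
    exact ⟨by rw [e0, h0, h1]; ring, by rw [e1, h0, h1]; ring, by rw [e4, h4]⟩
  · intro hB x h1 h3 h4
    obtain ⟨e0, e1, e2, e3, e4⟩ := blockDiag_fin5_apply N x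
    exact ⟨by rw [e1, h1, hB]; ring, by rw [e3, h3], by rw [e4, h4]⟩

/-- **The per-term sign rule** (step (4) of the gauge, exactly as the encoder uses it): for
scalars with `d_i e_i = 1`, `(f_i, d_i g_i, e_i W_i)_i` computes the same map with the SAME X-forms —
over `𝔽₃` with `d_i = e_i = ±1` this makes the first nonzero trit of `(W_i | G_i)` equal to `1`. -/
theorem exists_rescale_gw {U V W : Type*} [AddCommGroup U] [Module k U] [AddCommGroup V] [Module k V]
    [AddCommGroup W] [Module k W] {φ : U →ₗ[k] V →ₗ[k] W} (β : BilinComp φ ι) (dg ew : ι → k)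
    (h : ∀ i, dg i * ew i = 1) :
    ∃ β' : BilinComp φ ι,
      (∀ i, β'.f i = β.f i) ∧ (∀ i, β'.g i = dg i • β.g i) ∧ (∀ i, β'.w i = ew i • β.w i) := by
  refine ⟨{ f := β.f, g := fun i => dg i • β.g i, w := fun i => ew i • β.w i,
            map_eq_sum := fun u v => ?_ }, fun i => rfl, fun i => rfl, fun i => rfl⟩
  rw [β.map_eq_sum u v]
  refine Finset.sum_congr rfl fun i _ => ?_
  simp only [LinearMap.smul_apply, smul_eq_mul, smul_smul]
  congr 1
  calc β.f i u * β.g i v = (dg i * ew i) * (β.f i u * β.g i v) := by rw [h i, one_mul]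
    _ = β.f i u * (dg i * β.g i v) * ew i := by ring

end Summit.MatrixMultiplication.OmegaCensus.RankOnePlaneCapGeneral
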